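import Summits.CriticalPhenomena.SAWScalingLimit.Theorems.SAWWeldingIdentificationWeldingLawOfLimitApprox

/-!
# Per-measure approximate welding identification (crux `WeldingLawOfLimit`, stmt-4502)

Route `SAWWeldingIdentification` of `CriticalPhenomena/SAWScalingLimit`, crux (W)
`WeldingLawOfLimit` (stmt-CriticalPhenomena-4502), line `registered`, held stub
`stub_approxWeldingLaw`. The tree already has the GLOBAL implication
`canonicalWeldingLaw_of_approxWeldingLaw` (all binders of the crux inlined) and the per-measure
EXACT identification `eq_map_of_chordSupport_of_forall_rat_marginals_eq`. This file records the
per-measure APPROXIMATE identification — the form in which a lattice argument (bank independence of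
the two-sided harmonic-measure parametrisation, read through Sheffield's quantum zipper) would be
invoked on ONE subsequential limit in ONE conformal rectangle, with only COUNTABLY many marginals
to control:

* `eq_map_of_chordSupport_of_tendsto_rat_weldingMarginals`: fix a conformal rectangle `Q` and a
  chordal SLE_{8/3} random curve `Γ` in `(Ω; a, b) = Q.chord 0 2`. If a chord-supported
  probability measure `P` on curve space is the weak limit of chord-supported probability measures
  `Pₙ`, and for every `k`, all positive RATIONAL `x₁, …, x_k` and every bounded continuous `g` on
  `ℝᵏ` the expectations `∫ g (conformalWelding Q γ xᵢ)ᵢ dPₙ` converge to the SLE_{8/3} value, then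
  `P = ℙ ∘ Γ⁻¹`;
* `isSLELaw_of_chordSupport_of_tendsto_rat_weldingMarginals`: the `IsSLELaw` form;
* `eq_map_of_chordSupport_of_tendsto_weldingMarginals`: the real-point form.

Proof: welding marginals pass to the chord-supported weak limit (`weldingMarginalsOfLimit`,
continuous mapping on the carrying Borel set of simple chords), limits in `ℝ` are unique, integrals
of bounded continuous functions determine a finite Borel measure on `ℝᵏ`
(`ext_of_forall_integral_eq_of_IsFiniteMeasure`), and a chord-supported law with the SLE_{8/3}
canonical-welding marginals at positive rationals is the SLE_{8/3} law
(`eq_map_of_chordSupport_of_forall_rat_marginals_eq`: one-sided welding rigidity of removable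
chords + identification by disintegration). No new definition, no named fact.

References: Billingsley (1999) §2; Sheffield, Ann. Probab. 44 (2016) §1.4; Rohde–Schramm, Ann.
Math. 161 (2005) Thms 5.2, 6.1; Jones–Smirnov, Ark. Mat. 38 (2000).
-/

noncomputable section

open MeasureTheory Filter Topology Set
open Literature.Probability.RandomPlanarGeometry Literature.Probability.LatticeModels
open Literature.Probability.Process (preWienerMeasure)
open Summit.CriticalPhenomena.SAWScalingLimit.Theses

namespace Summit.CriticalPhenomena.SAWScalingLimit.Theorems.WeldingLawOfLimit

/-- **Per-measure approximate welding identification (rational points).** Let `Q` be a conformal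
rectangle, `Γ` a chordal SLE_{8/3} random curve in `(Ω; a, b) = Q.chord 0 2`, `P` a probability
measure on `CurveClass ℂ` carried by the simple chords of `(Ω; a, b)`, and `Pₙ` chord-supported
probability measures converging weakly to `P`. If for every `k`, all positive rationals
`x₁, …, x_k` and every bounded continuous `g : ℝᵏ → ℝ`,
`∫ g (conformalWelding Q γ xᵢ)ᵢ dPₙ → ∫ g (conformalWelding Q γ xᵢ)ᵢ d(ℙ ∘ Γ⁻¹)`, then
`P = ℙ ∘ Γ⁻¹`. Sheffield (2016) §1.4; Billingsley (1999) §2. [folklore] -/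
theorem eq_map_of_chordSupport_of_tendsto_rat_weldingMarginals (Q : ConformalRectangle)
    {Γ : (NNReal → ℝ) → CurveClass ℂ} (hΓ : IsSLECurve ((8 : NNReal) / 3) (Q.chord 0 2 (by decide)) Γ)
    (P : Measure (CurveClass ℂ)) [IsProbabilityMeasure P]
    (hP : ∀ᵐ γ ∂P, (Q.chord 0 2 (by decide)).IsSimpleChord γ)
    (Ps : ℕ → Measure (CurveClass ℂ)) (hPs : ∀ n, IsProbabilityMeasure (Ps n))
    (hPsch : ∀ n, ∀ᵐ γ ∂(Ps n), (Q.chord 0 2 (by decide)).IsSimpleChord γ)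
    (hlim : ∀ f : BoundedContinuousFunction (CurveClass ℂ) ℝ,
      Tendsto (fun n => ∫ γ, f γ ∂(Ps n)) atTop (𝓝 (∫ γ, f γ ∂P)))
    (hweld : ∀ (k : ℕ) (x : Fin k → ℚ), (∀ i, 0 < x i) →
      ∀ g : BoundedContinuousFunction (Fin k → ℝ) ℝ,
        Tendsto (fun n => ∫ γ, g (fun i => conformalWelding Q γ (x i)) ∂(Ps n)) atTop
          (𝓝 (∫ γ, g (fun i => conformalWelding Q γ (x i)) ∂(preWienerMeasure.map Γ)))) :
    P = preWienerMeasure.map Γ := by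
  haveI : IsProbabilityMeasure preWienerMeasure :=
    Literature.Probability.RandomPlanarGeometry.isProbabilityMeasure_preWienerMeasure'
  haveI : IsProbabilityMeasure (preWienerMeasure.map Γ) := Measure.isProbabilityMeasure_map hΓ.1
  refine eq_map_of_chordSupport_of_forall_rat_marginals_eq Q P hP hΓ fun k x hx => ?_
  -- the welding vector at the real points `(xᵢ : ℝ)ᵢ`
  have hVm := measurable_weldingVector Q (fun i => (x i : ℝ))
  refine ext_of_forall_integral_eq_of_IsFiniteMeasure fun g => ?_
  rw [integral_map hVm.aemeasurable g.continuous.aestronglyMeasurable,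
    integral_map hVm.aemeasurable g.continuous.aestronglyMeasurable]
  -- two limits of the same real sequence
  exact tendsto_nhds_unique
    (weldingMarginalsOfLimit Q Ps P hPs ‹_› hPsch hP hlim k (fun i => (x i : ℝ)) g) (hweld k x hx g)

/-- `IsSLELaw` form of `eq_map_of_chordSupport_of_tendsto_rat_weldingMarginals`: a chord-supported
weak limit of chord-supported probability measures whose canonical-welding marginals at positive
rationals converge to those of SOME chordal SLE_{8/3} curve in `(Ω; a, b)` is a chordal SLE_{8/3}
law in `(Ω; a, b)`. [folklore] -/
theorem isSLELaw_of_chordSupport_of_tendsto_rat_weldingMarginals (Q : ConformalRectangle)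
    {Γ : (NNReal → ℝ) → CurveClass ℂ} (hΓ : IsSLECurve ((8 : NNReal) / 3) (Q.chord 0 2 (by decide)) Γ)
    (P : Measure (CurveClass ℂ)) [IsProbabilityMeasure P]
    (hP : ∀ᵐ γ ∂P, (Q.chord 0 2 (by decide)).IsSimpleChord γ)
    (Ps : ℕ → Measure (CurveClass ℂ)) (hPs : ∀ n, IsProbabilityMeasure (Ps n))
    (hPsch : ∀ n, ∀ᵐ γ ∂(Ps n), (Q.chord 0 2 (by decide)).IsSimpleChord γ)
    (hlim : ∀ f : BoundedContinuousFunction (CurveClass ℂ) ℝ,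
      Tendsto (fun n => ∫ γ, f γ ∂(Ps n)) atTop (𝓝 (∫ γ, f γ ∂P)))
    (hweld : ∀ (k : ℕ) (x : Fin k → ℚ), (∀ i, 0 < x i) →
      ∀ g : BoundedContinuousFunction (Fin k → ℝ) ℝ,
        Tendsto (fun n => ∫ γ, g (fun i => conformalWelding Q γ (x i)) ∂(Ps n)) atTop
          (𝓝 (∫ γ, g (fun i => conformalWelding Q γ (x i)) ∂(preWienerMeasure.map Γ)))) :
    IsSLELaw ((8 : NNReal) / 3) (Q.chord 0 2 (by decide)) P :=
  ⟨Γ, hΓ, eq_map_of_chordSupport_of_tendsto_rat_weldingMarginals Q hΓ P hP Ps hPs hPsch hlim hweld⟩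

/-- Real-point form of `eq_map_of_chordSupport_of_tendsto_rat_weldingMarginals` (the shape in
which the registered stub `ApproxWeldingLaw` delivers the convergence: all positive REAL points).
[folklore] -/
theorem eq_map_of_chordSupport_of_tendsto_weldingMarginals (Q : ConformalRectangle)
    {Γ : (NNReal → ℝ) → CurveClass ℂ} (hΓ : IsSLECurve ((8 : NNReal) / 3) (Q.chord 0 2 (by decide)) Γ)
    (P : Measure (CurveClass ℂ)) [IsProbabilityMeasure P]
    (hP : ∀ᵐ γ ∂P, (Q.chord 0 2 (by decide)).IsSimpleChord γ)
    (Ps : ℕ → Measure (CurveClass ℂ)) (hPs : ∀ n, IsProbabilityMeasure (Ps n))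
    (hPsch : ∀ n, ∀ᵐ γ ∂(Ps n), (Q.chord 0 2 (by decide)).IsSimpleChord γ)
    (hlim : ∀ f : BoundedContinuousFunction (CurveClass ℂ) ℝ,
      Tendsto (fun n => ∫ γ, f γ ∂(Ps n)) atTop (𝓝 (∫ γ, f γ ∂P)))
    (hweld : ∀ (k : ℕ) (x : Fin k → ℝ), (∀ i, 0 < x i) →
      ∀ g : BoundedContinuousFunction (Fin k → ℝ) ℝ,
        Tendsto (fun n => ∫ γ, g (fun i => conformalWelding Q γ (x i)) ∂(Ps n)) atTop
          (𝓝 (∫ γ, g (fun i => conformalWelding Q γ (x i)) ∂(preWienerMeasure.map Γ)))) :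
    P = preWienerMeasure.map Γ :=
  eq_map_of_chordSupport_of_tendsto_rat_weldingMarginals Q hΓ P hP Ps hPs hPsch hlim
    fun k x hx g => hweld k (fun i => (x i : ℝ)) (fun i => by exact_mod_cast hx i) g

/-- **Registered sub-goal `approxWeldingIdentification`** of crux `WeldingLawOfLimit`
(stmt-CriticalPhenomena-4502), line `registered`: the binder-free form of
`eq_map_of_chordSupport_of_tendsto_rat_weldingMarginals` — in one conformal rectangle, a
chord-supported weak limit of chord-supported probability measures whose canonical-welding
marginals at positive rationals converge to chordal SLE_{8/3}'s is the SLE_{8/3} law. This is the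
per-measure entry point for the held stub `ApproxWeldingLaw` (= stmt-0783 modulo stmt-4982).
[folklore] -/
theorem approxWeldingIdentification :
    ∀ (Q : ConformalRectangle) (Γ : (NNReal → ℝ) → CurveClass ℂ),
    IsSLECurve ((8 : NNReal) / 3) (Q.chord 0 2 (by decide)) Γ →
    ∀ (P : Measure (CurveClass ℂ)), IsProbabilityMeasure P →
    (∀ᵐ γ ∂P, (Q.chord 0 2 (by decide)).IsSimpleChord γ) →
    ∀ (Ps : ℕ → Measure (CurveClass ℂ)), (∀ n, IsProbabilityMeasure (Ps n)) →
    (∀ n, ∀ᵐ γ ∂(Ps n), (Q.chord 0 2 (by decide)).IsSimpleChord γ) →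
    (∀ f : BoundedContinuousFunction (CurveClass ℂ) ℝ,
      Tendsto (fun n => ∫ γ, f γ ∂(Ps n)) atTop (𝓝 (∫ γ, f γ ∂P))) →
    (∀ (k : ℕ) (x : Fin k → ℚ), (∀ i, 0 < x i) →
      ∀ g : BoundedContinuousFunction (Fin k → ℝ) ℝ,
        Tendsto (fun n => ∫ γ, g (fun i => conformalWelding Q γ (x i)) ∂(Ps n)) atTop
          (𝓝 (∫ γ, g (fun i => conformalWelding Q γ (x i)) ∂(preWienerMeasure.map Γ)))) →
    P = preWienerMeasure.map Γ := by
  intro Q Γ hΓ P hP hPch Ps hPs hPsch hlim hweld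
  exact eq_map_of_chordSupport_of_tendsto_rat_weldingMarginals Q hΓ P hPch Ps hPs hPsch hlim hweld

end Summit.CriticalPhenomena.SAWScalingLimit.Theorems.WeldingLawOfLimit

end
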